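import Literature.Analysis.FluidPDE.TorusVorticityTensorTransport
import HarnessLib

/-!
# The helicity balance `dH/dt = 2ν∫Δu·ω + 2∫f·ω = −2ν∫ω·curl ω + 2∫f·ω` along classical
# Navier–Stokes solutions on `T³`

Analysis/FluidPDE proof file (theorems only; no definitions, no named facts).

Search for candidate a priori estimates; no regularity claim. The **helicity**
`H = ∫ u·ω dx` (`ω = curl u`) of a classical solution of `∂ₜu + (u·∇)u = νΔu − ∇p + f`,
`div u = 0` on the periodic box satisfies the exact balance

`dH/dt = 2ν ∫ Δu·ω dx + 2∫ f·ω dx = −2ν ∫ ω·curl ω dx + 2∫ f·ω dx`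

(conservation for ideal flow, `ν = 0`: Moffatt 1969; Majda–Bertozzi 2002, Prop. 1.12 (iv), eq. (1.67)
and its proof p. 29; Chorin 1994, §1.2; Doering–Gibbon 1995, Exercise 7.4 (E7.4); for viscous flow
the extra term is `2ν∫Δu·ω = −2ν∫ω·curl ω`, the "viscous destruction of helicity" of the review
Moffatt–Tsinober 1992 — here obtained by the same three-line computation); the transport and pressure terms
drop out because `∫ a·curl b = ∫ curl a·b` on the torus, `curl ∇φ = 0`, `(u·∇)u = ω × u + ∇(|u|²/2)`
and `(ω × u)·ω = 0`. Here this is PROVED on the unit torus `T^d`, `card d = 3`, in the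
orientation-free vocabulary of the tree: for a labelling `e : d ≃ Fin 3` the curl read in the
frame `e` is `(curlₑ a)ᵢ = ∂_{i⁺} a_{i⁺⁺} − ∂_{i⁺⁺} a_{i⁺}` with `i⁺ = e⁻¹(e i + 1)`,
`i⁺⁺ = e⁻¹(e i + 2)`, so that `(curlₑ u)ᵢ = W_{i⁺ i⁺⁺}` (`W = torusVorticityTensor`, as in
`torusVorticitySqAt_eq_sum_sq_of_equiv`), and the helicity is `Hₑ(t) = ∫ ∑ᵢ uᵢ W_{i⁺ i⁺⁺}` (a
pseudo-scalar: reversing the orientation of `e` flips its sign; `|H|`, `H²` do not depend on `e`):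

* (private tools) `∫ ∑ᵢ aᵢ (curlₑ b)ᵢ = ∫ ∑ᵢ (curlₑ a)ᵢ bᵢ` (integration by parts; the curl is
  `L²`-symmetric on the torus), `∫ ∇φ · curlₑ b = 0`, `∑ᵢⱼ uⱼ Wⱼᵢ ωᵢ = 0` pointwise (`(ω × u)·ω = 0`).
* `Torus.curl_curl_eq_neg_laplacian_of_isDivFree` — `curlₑ ω = −Δu` pointwise for smooth
  divergence-free `u` (`curl curl = ∇div − Δ`).
* `Torus.IsClassicalNSSolutionOn.hasDerivWithinAt_helicity` — **the balance**: along a classical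
  solution on `[a, b] × T^d` (`a < b`, any `ν`, any forcing `f`), `Hₑ` has one-sided derivative
  `2ν∫∑ᵢ(Δu)ᵢωᵢ + 2∫∑ᵢ fᵢωᵢ` within `[a, b]` at every `t`; and
  `Torus.IsClassicalNSSolutionOn.hasDerivWithinAt_helicity'` — the same with the dissipation
  written `−2ν∫∑ᵢ ωᵢ(curlₑ ω)ᵢ`. For `ν = 0`, `f = 0` (classical Euler): `Hₑ` is constant
  (`Torus.IsClassicalNSSolutionOn.helicity_eq_of_euler`).

Scope (faithfulness): classical solutions on the unit torus; exact identities, no estimates.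

## Mathlib / tree search

Tree (used): `torusVorticityTensor`, `torusVorticitySqAt_eq_sum_sq_of_equiv` (the frame-`e`
curl), `Torus.IsSmoothSpaceTimeOn.hasDerivWithinAt_integral` (differentiation under `∫`),
`Torus.timeDerivWithin_partialDeriv_comm`, `Torus.timeDerivWithin_clm_comp`,
`Torus.integral_partialDeriv_eq_zero_holds`, `Torus.partialDeriv_mul`, `Torus.partialDeriv_comm`,
`Torus.partialDeriv_apply_coord`, `Torus.fderiv_apply_eq_sum_partialDeriv`,
`Torus.laplacian_eq_sum_partialDeriv_partialDeriv`, `Torus.gradient_eq_sum_partialDeriv`.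
Searched (`lean search`): `helicity` — only the `ℝ³` Euler conservation
(`NSVorticityHelicityProofs`, `euler_helicity_conservation`) and `Superhelicity`; no torus balance.

## References

* [MajdaBertozziCUP2002] A. J. Majda, A. L. Bertozzi, *Vorticity and Incompressible Flow*,
  CUP 2002, §1.4 (1.19)–(1.21); Prop. 1.12 (iv), eq. (1.67), proof p. 29 (held text).
* [Moffatt1969] H. K. Moffatt, *The degree of knottedness of tangled vortex lines*, J. Fluid
  Mech. 35 (1969) 117–129 (the invariant; not held — acquisition request acq-09104).
* [MoffattTsinober1992] H. K. Moffatt, A. Tsinober, *Helicity in laminar and turbulent flow*,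
  Annu. Rev. Fluid Mech. 24 (1992) 281–312 (review; viscous helicity balance).
* C. R. Doering, J. D. Gibbon, *Applied Analysis of the Navier–Stokes Equations*, CUP 1995,
  Exercise 7.4 (E7.4) (held text); A. J. Chorin, *Vorticity and Turbulence*, Springer 1994, §1.2
  (held text).
-/

noncomputable section

open Set MeasureTheory Finset
open scoped ContDiff InnerProductSpace RealInnerProductSpace Topology

namespace Literature.Analysis.FluidPDE

open Literature.Analysis.FunctionSpaces

variable {d : Type*} [Fintype d] [DecidableEq d]

/-! ### Frame bookkeeping: sums over `d` through `e : d ≃ Fin 3` -/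

omit [DecidableEq d] in
/-- Sums over `d` read through a frame `e : d ≃ Fin 3`. [folklore] -/
private theorem sum_eq_sum_fin_three₁₀ (e : d ≃ Fin 3) (G : d → ℝ) :
    ∑ i, G i = ∑ a : Fin 3, G (e.symm a) :=
  Fintype.sum_equiv e _ _ fun i => by simp

omit [Fintype d] [DecidableEq d] in
/-- Addition table of `Fin 3`. [folklore] -/
private theorem fin3_add₁₀ :
    (0 : Fin 3) + 1 = 1 ∧ (0 : Fin 3) + 2 = 2 ∧ (1 : Fin 3) + 1 = 2 ∧ (1 : Fin 3) + 2 = 0 ∧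
      (2 : Fin 3) + 1 = 0 ∧ (2 : Fin 3) + 2 = 1 := by
  decide

/-! ### The curl is `L²`-symmetric on the torus; `curl ∇ = 0` -/

/-- Integration by parts for one partial derivative (smooth real functions). [folklore] -/
private theorem integral_mul_partialDeriv₁₀ {α β : UnitAddTorus d → ℝ} (hα : Torus.IsSmooth α)
    (hβ : Torus.IsSmooth β) (k : d) :
    ∫ x, α x * Torus.partialDeriv k β x = -∫ x, Torus.partialDeriv k α x * β x := by
  have hab : Torus.IsSmooth (fun y => α y * β y) := hα.mul hβ
  have h1 : Torus.IsSmooth (fun y => α y * Torus.partialDeriv k β y) := hα.mul (hβ.partialDeriv k)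
  have h2 : Torus.IsSmooth (fun y => Torus.partialDeriv k α y * β y) := (hα.partialDeriv k).mul hβ
  have h0 : ∫ x, Torus.partialDeriv k (fun y => α y * β y) x = 0 :=
    Torus.integral_partialDeriv_eq_zero_holds hab k
  simp_rw [Torus.partialDeriv_mul (hα.isContDiff (by simp)) (hβ.isContDiff (by simp))] at h0
  rw [integral_add h1.integrable h2.integrable] at h0
  linarith

/-- **`∫ a · curlₑ b = ∫ curlₑ a · b`** on `T^d`, `card d = 3`, for smooth scalar families
`a, b : d → (T^d → ℝ)` and a frame `e : d ≃ Fin 3` (`(curlₑ b)ᵢ = ∂_{i⁺}b_{i⁺⁺} − ∂_{i⁺⁺}b_{i⁺}`,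
`i⁺ = e⁻¹(e i + 1)`, `i⁺⁺ = e⁻¹(e i + 2)`): integration by parts (the Green's-formula step of
Majda–Bertozzi 2002, proof of Prop. 1.12, p. 29). [folklore] -/
private theorem Torus.integral_sum_mul_curl_eq (e : d ≃ Fin 3) {A B : d → UnitAddTorus d → ℝ}
    (hA : ∀ i, Torus.IsSmooth (A i)) (hB : ∀ i, Torus.IsSmooth (B i)) :
    ∫ x, ∑ i, A i x * (Torus.partialDeriv (e.symm (e i + 1)) (B (e.symm (e i + 2))) x -
        Torus.partialDeriv (e.symm (e i + 2)) (B (e.symm (e i + 1))) x) =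
      ∫ x, ∑ i, (Torus.partialDeriv (e.symm (e i + 1)) (A (e.symm (e i + 2))) x -
        Torus.partialDeriv (e.symm (e i + 2)) (A (e.symm (e i + 1))) x) * B i x := by
  -- the elementary integrals `I p q r = ∫ ∂_{e⁻¹p} A_{e⁻¹q} · B_{e⁻¹r}`
  set I : Fin 3 → Fin 3 → Fin 3 → ℝ := fun p q r =>
    ∫ x, Torus.partialDeriv (e.symm p) (A (e.symm q)) x * B (e.symm r) x with hI
  have hsm1 : ∀ i p q, Torus.IsSmooth (fun x => A i x * Torus.partialDeriv p (B q) x) :=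
    fun i p q => (hA i).mul ((hB q).partialDeriv p)
  have hsm2 : ∀ i p q, Torus.IsSmooth (fun x => Torus.partialDeriv p (A q) x * B i x) :=
    fun i p q => ((hA q).partialDeriv p).mul (hB i)
  have hL : ∀ i, Integrable (fun x => A i x * (Torus.partialDeriv (e.symm (e i + 1))
      (B (e.symm (e i + 2))) x - Torus.partialDeriv (e.symm (e i + 2)) (B (e.symm (e i + 1))) x)) := by
    intro i
    have := ((hsm1 i (e.symm (e i + 1)) (e.symm (e i + 2))).sub
      (hsm1 i (e.symm (e i + 2)) (e.symm (e i + 1)))).integrable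
    refine this.congr (ae_of_all _ fun x => ?_)
    simp only [Pi.sub_apply]; ring
  have hR : ∀ i, Integrable (fun x => (Torus.partialDeriv (e.symm (e i + 1)) (A (e.symm (e i + 2))) x -
      Torus.partialDeriv (e.symm (e i + 2)) (A (e.symm (e i + 1))) x) * B i x) := by
    intro i
    have := ((hsm2 i (e.symm (e i + 1)) (e.symm (e i + 2))).sub
      (hsm2 i (e.symm (e i + 2)) (e.symm (e i + 1)))).integrable
    refine this.congr (ae_of_all _ fun x => ?_)
    simp only [Pi.sub_apply]; ring
  rw [integral_finsetSum _ fun i _ => hL i, integral_finsetSum _ fun i _ => hR i]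
  -- each summand: split and integrate by parts; express through `I`
  have hLi : ∀ i, ∫ x, A i x * (Torus.partialDeriv (e.symm (e i + 1)) (B (e.symm (e i + 2))) x -
      Torus.partialDeriv (e.symm (e i + 2)) (B (e.symm (e i + 1))) x) =
      -I (e i + 1) (e i) (e i + 2) + I (e i + 2) (e i) (e i + 1) := by
    intro i
    simp_rw [mul_sub]
    rw [integral_sub (hsm1 i _ _).integrable (hsm1 i _ _).integrable,
      integral_mul_partialDeriv₁₀ (hA i) (hB _), integral_mul_partialDeriv₁₀ (hA i) (hB _), hI]
    simp only [Equiv.symm_apply_apply]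
    ring
  have hRi : ∀ i, ∫ x, (Torus.partialDeriv (e.symm (e i + 1)) (A (e.symm (e i + 2))) x -
      Torus.partialDeriv (e.symm (e i + 2)) (A (e.symm (e i + 1))) x) * B i x =
      I (e i + 1) (e i + 2) (e i) - I (e i + 2) (e i + 1) (e i) := by
    intro i
    simp_rw [sub_mul]
    rw [integral_sub (hsm2 i _ _).integrable (hsm2 i _ _).integrable, hI]
    simp only [Equiv.symm_apply_apply]
  simp_rw [hLi, hRi]
  rw [sum_eq_sum_fin_three₁₀ e, sum_eq_sum_fin_three₁₀ e]
  obtain ⟨h01, h02, h11, h12, h21, h22⟩ := fin3_add₁₀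
  simp only [Equiv.apply_symm_apply, Fin.sum_univ_three, zero_add, h11, h12, h21, h22]
  ring

/-- **`∫ ∇φ · curlₑ b = 0`** on `T^d`, `card d = 3` (`∫∇φ·curl b = ∫curl∇φ·b` and `curl ∇φ = 0` by the
symmetry of second derivatives; Majda–Bertozzi 2002 (2.96) `div curl = 0`). [folklore] -/
private theorem Torus.integral_sum_partialDeriv_mul_curl_eq_zero (e : d ≃ Fin 3) {φ : UnitAddTorus d → ℝ}
    (hφ : Torus.IsSmooth φ) {B : d → UnitAddTorus d → ℝ} (hB : ∀ i, Torus.IsSmooth (B i)) :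
    ∫ x, ∑ i, Torus.partialDeriv i φ x * (Torus.partialDeriv (e.symm (e i + 1)) (B (e.symm (e i + 2))) x -
        Torus.partialDeriv (e.symm (e i + 2)) (B (e.symm (e i + 1))) x) = 0 := by
  rw [Torus.integral_sum_mul_curl_eq e (fun i => hφ.partialDeriv i) hB]
  have h0 : ∀ i x, Torus.partialDeriv (e.symm (e i + 1)) (Torus.partialDeriv (e.symm (e i + 2)) φ) x -
      Torus.partialDeriv (e.symm (e i + 2)) (Torus.partialDeriv (e.symm (e i + 1)) φ) x = 0 := by
    intro i x
    rw [Torus.partialDeriv_comm hφ, sub_self]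
  simp [h0]

/-! ### Pointwise identities in the frame: `(ω × u)·ω = 0` and `curl curl = −Δ` -/

/-- **`∑ᵢⱼ uⱼ Wⱼᵢ ωᵢ = 0` pointwise** (`Wⱼᵢ = (∂ⱼu)ᵢ − (∂ᵢu)ⱼ`, `ωᵢ = W_{i⁺ i⁺⁺}`; in vector
notation `∑ⱼuⱼWⱼᵢ = (ω × u)ᵢ` up to sign, and `(ω × u)·ω = 0`). [folklore] -/
private theorem Torus.sum_sum_mul_torusVorticityTensor_mul_curl_eq_zero (e : d ≃ Fin 3)
    (v : UnitAddTorus d → EuclideanSpace ℝ d) (x : UnitAddTorus d) :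
    ∑ i, ∑ j, v x j * torusVorticityTensor v j i x *
      torusVorticityTensor v (e.symm (e i + 1)) (e.symm (e i + 2)) x = 0 := by
  set P : Fin 3 → Fin 3 → ℝ := fun a b => Torus.partialDeriv (e.symm a) v x (e.symm b) with hP
  set U : Fin 3 → ℝ := fun a => v x (e.symm a) with hU
  have hterm : ∀ i j, v x j * torusVorticityTensor v j i x *
      torusVorticityTensor v (e.symm (e i + 1)) (e.symm (e i + 2)) x =
      U (e j) * (P (e j) (e i) - P (e i) (e j)) * (P (e i + 1) (e i + 2) - P (e i + 2) (e i + 1)) := by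
    intro i j
    simp only [hP, hU, torusVorticityTensor, Equiv.symm_apply_apply]
  simp_rw [hterm]
  rw [sum_eq_sum_fin_three₁₀ e]
  simp_rw [sum_eq_sum_fin_three₁₀ e (fun j => U (e j) * (P (e j) _ - P _ (e j)) * _)]
  obtain ⟨h01, h02, h11, h12, h21, h22⟩ := fin3_add₁₀
  simp only [Equiv.apply_symm_apply, Fin.sum_univ_three, zero_add, h11, h12, h21, h22]
  ring

/-- `∂ₖW_{ij} = (∂ₖ∂ᵢv)ⱼ − (∂ₖ∂ⱼv)ᵢ` for smooth `v` (copy of the tree's private lemma). [folklore] -/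
private theorem partialDeriv_W₁₀ {v : UnitAddTorus d → EuclideanSpace ℝ d}
    (hv : Torus.IsSmooth v) (i j k : d) (x : UnitAddTorus d) :
    Torus.partialDeriv k (torusVorticityTensor v i j) x =
      Torus.partialDeriv k (Torus.partialDeriv i v) x j -
        Torus.partialDeriv k (Torus.partialDeriv j v) x i := by
  have hi : Torus.IsContDiff 1 (fun y => Torus.partialDeriv i v y j) :=
    ((hv.partialDeriv i).apply j).isContDiff (by simp)
  have hj : Torus.IsContDiff 1 (fun y => -Torus.partialDeriv j v y i) :=
    ((hv.partialDeriv j).apply i).neg.isContDiff (by simp)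
  have hfun : torusVorticityTensor v i j =
      (fun y => Torus.partialDeriv i v y j) + fun y => -Torus.partialDeriv j v y i := by
    funext y; simp [torusVorticityTensor, sub_eq_add_neg]
  rw [hfun, Torus.partialDeriv_add hi hj k, Pi.add_apply, Torus.partialDeriv_neg,
    Torus.partialDeriv_apply_coord ((hv.partialDeriv i).isContDiff (by simp)),
    Torus.partialDeriv_apply_coord ((hv.partialDeriv j).isContDiff (by simp))]
  ring

/-- **`curlₑ(curlₑ v) = −Δv` pointwise for smooth divergence-free `v`** on `T^d`, `card d = 3`
(`−curl curl ψ + ∇div ψ = Δψ`, Majda–Bertozzi 2002, §2.4 eq. (2.97); here `ωₘ = W_{m⁺ m⁺⁺}` as a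
function and `(curlₑ ω)ₖ = ∂_{k⁺}ω_{k⁺⁺} − ∂_{k⁺⁺}ω_{k⁺}`). [cite: MajdaBertozziCUP2002, §2.4 eq. (2.97)] -/
theorem Torus.curl_curl_eq_neg_laplacian_of_isDivFree (e : d ≃ Fin 3)
    {v : UnitAddTorus d → EuclideanSpace ℝ d} (hv : Torus.IsSmooth v) (hdiv : Torus.IsDivFree v)
    (k : d) (x : UnitAddTorus d) :
    Torus.partialDeriv (e.symm (e k + 1))
        (torusVorticityTensor v (e.symm (e (e.symm (e k + 2)) + 1)) (e.symm (e (e.symm (e k + 2)) + 2))) x -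
      Torus.partialDeriv (e.symm (e k + 2))
        (torusVorticityTensor v (e.symm (e (e.symm (e k + 1)) + 1)) (e.symm (e (e.symm (e k + 1)) + 2))) x =
      -Torus.laplacian v x k := by
  -- second derivatives of the components in the frame: `H a b c = (∂ₐ∂_b v)_c`
  set H : Fin 3 → Fin 3 → Fin 3 → ℝ := fun a b c =>
    Torus.partialDeriv (e.symm a) (Torus.partialDeriv (e.symm b) v) x (e.symm c) with hH
  have hsym : ∀ a b c, H a b c = H b a c := fun a b c => by
    simp only [hH]
    rw [Torus.partialDeriv_comm hv (e.symm a) (e.symm b) x]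
  -- `∂ₐ W_{bc} = H a b c − H a c b`
  have hW : ∀ a b c : Fin 3, Torus.partialDeriv (e.symm a) (torusVorticityTensor v (e.symm b) (e.symm c)) x =
      H a b c - H a c b := fun a b c => by
    rw [partialDeriv_W₁₀ hv, hH]
  -- the Laplacian of the `k`-th component
  have hlap : ∀ c : Fin 3, Torus.laplacian v x (e.symm c) = ∑ a : Fin 3, H a a c := by
    intro c
    have hvk : Torus.IsSmooth (fun y => v y (e.symm c)) := hv.apply _
    have e1 : Torus.laplacian v x (e.symm c) = Torus.laplacian (fun y => v y (e.symm c)) x := by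
      have := Torus.laplacian_clm_comp_apply hv (EuclideanSpace.proj (e.symm c) : EuclideanSpace ℝ d →L[ℝ] ℝ) x
      simpa [Function.comp_def] using this.symm
    rw [e1, Torus.laplacian_eq_sum_partialDeriv_partialDeriv hvk, sum_eq_sum_fin_three₁₀ e]
    refine Finset.sum_congr rfl fun a _ => ?_
    simp only [hH]
    have e2 : Torus.partialDeriv (e.symm a) (fun y => v y (e.symm c)) =
        fun y => Torus.partialDeriv (e.symm a) v y (e.symm c) := by
      funext y; exact Torus.partialDeriv_apply_coord (hv.isContDiff (by simp)) _ y _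
    rw [e2, Torus.partialDeriv_apply_coord ((hv.partialDeriv _).isContDiff (by simp))]
  -- the derivative of the divergence vanishes: `∑ₐ H c a a = 0`
  have hdivk : ∀ c : Fin 3, ∑ a : Fin 3, H c a a = 0 := by
    intro c
    have h0 : Torus.divergence v = fun _ => (0 : ℝ) := funext hdiv
    have h1 : Torus.partialDeriv (e.symm c) (Torus.divergence v) x = 0 := by
      rw [h0]; simp [Torus.partialDeriv, Torus.lineDeriv]
    have hdivfun : Torus.divergence v = fun y => ∑ i, Torus.partialDeriv i (fun z => v z i) y :=
      funext fun y => rfl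
    rw [hdivfun, Torus.partialDeriv_finset_sum Finset.univ
      (fun i _ => ((hv.apply i).partialDeriv i).isContDiff (by simp)) (e.symm c) x,
      sum_eq_sum_fin_three₁₀ e] at h1
    rw [← h1]
    refine Finset.sum_congr rfl fun a _ => ?_
    simp only [hH]
    have e2 : Torus.partialDeriv (e.symm a) (fun y => v y (e.symm a)) =
        fun y => Torus.partialDeriv (e.symm a) v y (e.symm a) := by
      funext y; exact Torus.partialDeriv_apply_coord (hv.isContDiff (by simp)) _ y _
    rw [e2, Torus.partialDeriv_apply_coord ((hv.partialDeriv _).isContDiff (by simp))]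
  -- reduce to the frame and compute
  obtain ⟨c, rfl⟩ : ∃ c, k = e.symm c := ⟨e k, (e.symm_apply_apply k).symm⟩
  obtain ⟨h01, h02, h11, h12, h21, h22⟩ := fin3_add₁₀
  simp only [Equiv.apply_symm_apply]
  rw [hlap c]
  have hc : c = 0 ∨ c = 1 ∨ c = 2 := by
    fin_cases c <;> simp
  rcases hc with rfl | rfl | rfl
  · simp only [zero_add, h11, h12, h21, h22, hW, Fin.sum_univ_three]
    have := hdivk 0
    simp only [Fin.sum_univ_three] at this
    linarith [hsym 0 1 1, hsym 0 2 2, hsym 1 0 0]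
  · simp only [h11, h12, h21, h22, h01, h02, hW, Fin.sum_univ_three]
    have := hdivk 1
    simp only [Fin.sum_univ_three] at this
    linarith [hsym 1 0 0, hsym 1 2 2, hsym 0 1 1, hsym 2 1 1]
  · simp only [h11, h12, h21, h22, h01, h02, hW, Fin.sum_univ_three]
    have := hdivk 2
    simp only [Fin.sum_univ_three] at this
    linarith [hsym 2 0 0, hsym 2 1 1, hsym 0 2 2, hsym 1 2 2]

/-! ### The helicity balance -/

/-- `Wᵢⱼ(u(s))` is jointly smooth along a jointly smooth `u`. [folklore] -/
private theorem isSmoothSpaceTimeOn_W₁₀ {a b : ℝ}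
    {u : ℝ → UnitAddTorus d → EuclideanSpace ℝ d} (hu : Torus.IsSmoothSpaceTimeOn (Icc a b) u)
    (hab : a < b) (i j : d) :
    Torus.IsSmoothSpaceTimeOn (Icc a b) (fun s y => torusVorticityTensor (u s) i j y) :=
  ((hu.partialDeriv (uniqueDiffOn_Icc hab) i).apply j).sub
    ((hu.partialDeriv (uniqueDiffOn_Icc hab) j).apply i)

/-- `Wᵢⱼ` of a smooth field is smooth. [folklore] -/
private theorem isSmooth_W₁₀ {v : UnitAddTorus d → EuclideanSpace ℝ d} (hv : Torus.IsSmooth v)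
    (i j : d) : Torus.IsSmooth (torusVorticityTensor v i j) :=
  ((hv.partialDeriv i).apply j).sub ((hv.partialDeriv j).apply i)

/-- **The helicity balance on `T³`** (`H = ∫u·ω`, `ω = curl u`: conserved for ideal flow —
Moffatt 1969; Majda–Bertozzi 2002 Prop. 1.12 (iv), (1.67) — and `dH/dt = −2ν∫ω·curl ω + 2∫f·ω`
for viscous forced flow, Moffatt–Tsinober 1992). On `T^d`,
`card d = 3`, with a frame `e : d ≃ Fin 3` and `ωᵢ := W_{i⁺ i⁺⁺}(u)` (`i⁺ = e⁻¹(e i + 1)`,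
`i⁺⁺ = e⁻¹(e i + 2)`; the curl read in the frame `e`), along every classical solution of
`∂ₜu + (u·∇)u = νΔu − ∇p + f`, `div u = 0` on `[a, b] × T^d` (`a < b`; any `ν`, any forcing), the
helicity `Hₑ(t) = ∫ ∑ᵢ uᵢ ωᵢ dx` has the one-sided derivative

`dHₑ/dt = 2ν ∫ ∑ᵢ (Δu)ᵢ ωᵢ dx + 2 ∫ ∑ᵢ fᵢ ωᵢ dx`

within `[a, b]` at every `t ∈ [a, b]` (`∫u·∂ₜω = ∫u·curl ∂ₜu = ∫ω·∂ₜu`, so `dH/dt = 2∫∂ₜu·ω`;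
the pressure drops by `∫∇p·curl u = 0`, the transport term by `(u·∇)u = ∑ⱼuⱼWⱼ. + ∇(|u|²/2)`,
`∑ᵢⱼuⱼWⱼᵢωᵢ = 0` and `∫∇(|u|²/2)·curl u = 0`). The dissipation equals `−2ν∫∑ᵢωᵢ(curlₑ ω)ᵢ`
(`Torus.curl_curl_eq_neg_laplacian_of_isDivFree`). [cite: MajdaBertozziCUP2002, Prop. 1.12 (iv), eq. (1.67) (proof, p. 29)]
[cite: MoffattTsinober1992, review (viscous helicity balance)] -/
theorem _root_.Literature.Analysis.FunctionSpaces.Torus.IsClassicalNSSolutionOn.hasDerivWithinAt_helicity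
    (e : d ≃ Fin 3) {a b ν : ℝ} (hab : a < b)
    {u f : ℝ → UnitAddTorus d → EuclideanSpace ℝ d} {p : ℝ → UnitAddTorus d → ℝ}
    (h : Torus.IsClassicalNSSolutionOn (Icc a b) ν f u p) {t : ℝ} (ht : t ∈ Icc a b) :
    HasDerivWithinAt
      (fun s => ∫ x, ∑ i, u s x i * torusVorticityTensor (u s) (e.symm (e i + 1)) (e.symm (e i + 2)) x)
      (2 * ν * (∫ x, ∑ i, Torus.laplacian (u t) x i *
          torusVorticityTensor (u t) (e.symm (e i + 1)) (e.symm (e i + 2)) x) +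
        2 * (∫ x, ∑ i, f t x i * torusVorticityTensor (u t) (e.symm (e i + 1)) (e.symm (e i + 2)) x))
      (Icc a b) t := by
  have hU : UniqueDiffOn ℝ (Icc a b) := uniqueDiffOn_Icc hab
  have hus : Torus.IsSmoothSpaceTimeOn (Icc a b) u := h.smooth_velocity
  have hut : Torus.IsSmooth (u t) := hus.isSmooth_slice ht
  have hu1 : Torus.IsContDiff 1 (u t) := hut.isContDiff (by simp)
  have hpt : Torus.IsSmooth (p t) := h.smooth_pressure.isSmooth_slice ht
  -- abbreviations: the frame maps, the time derivative `A = ∂ₜu(t)`, the frame curl `ω`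
  set σ : d → d := fun i => e.symm (e i + 1) with hσ
  set τ : d → d := fun i => e.symm (e i + 2) with hτ
  set A : UnitAddTorus d → EuclideanSpace ℝ d := Torus.timeDerivWithin (Icc a b) u t with hA
  have hAs : Torus.IsSmooth A := hus.isSmooth_timeDerivWithin hU ht
  have hW : ∀ i j, Torus.IsSmooth (torusVorticityTensor (u t) i j) := fun i j => isSmooth_W₁₀ hut i j
  have huc : ∀ i, Torus.IsSmooth (fun y => u t y i) := fun i => hut.apply i
  have hAc : ∀ i, Torus.IsSmooth (fun y => A y i) := fun i => hAs.apply i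
  -- Step 1: differentiate under the integral
  have hφ : Torus.IsSmoothSpaceTimeOn (Icc a b)
      (fun s y => ∑ i, u s y i * torusVorticityTensor (u s) (σ i) (τ i) y) :=
    Torus.IsSmoothSpaceTimeOn.sum fun i _ => (hus.apply i).mul (isSmoothSpaceTimeOn_W₁₀ hus hab _ _)
  have hD := hφ.hasDerivWithinAt_integral (convex_Icc a b) ht
  -- Step 2: the time derivative of the integrand at `t`
  have hslice : ∀ y, Torus.timeDerivWithin (Icc a b)
      (fun s y => ∑ i, u s y i * torusVorticityTensor (u s) (σ i) (τ i) y) t y =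
      ∑ i, (A y i * torusVorticityTensor (u t) (σ i) (τ i) y +
        u t y i * (Torus.partialDeriv (σ i) A y (τ i) - Torus.partialDeriv (τ i) A y (σ i))) := by
    intro y
    -- derivative of the coordinates of `u`
    have hdu : ∀ i, HasDerivWithinAt (fun s => u s y i) (A y i) (Icc a b) t := fun i =>
      (EuclideanSpace.proj i : EuclideanSpace ℝ d →L[ℝ] ℝ).hasFDerivAt.comp_hasDerivWithinAt t
        (hus.hasDerivWithinAt_slice ht y)
    -- derivative of `(∂ⱼu(s))ₖ(y)`
    have hdD : ∀ j k, HasDerivWithinAt (fun s => Torus.partialDeriv j (u s) y k)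
        (Torus.partialDeriv j A y k) (Icc a b) t := by
      intro j k
      have h1 := (EuclideanSpace.proj k : EuclideanSpace ℝ d →L[ℝ] ℝ).hasFDerivAt.comp_hasDerivWithinAt t
        ((hus.partialDeriv hU j).hasDerivWithinAt_slice ht y)
      have e1 : Torus.timeDerivWithin (Icc a b) (fun s => Torus.partialDeriv j (u s)) t y =
          Torus.partialDeriv j A y := by
        rw [hA]; exact Torus.timeDerivWithin_partialDeriv_comm hab hus ht j y
      rw [e1] at h1
      exact h1
    have hdW : ∀ i, HasDerivWithinAt (fun s => torusVorticityTensor (u s) (σ i) (τ i) y)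
        (Torus.partialDeriv (σ i) A y (τ i) - Torus.partialDeriv (τ i) A y (σ i)) (Icc a b) t :=
      fun i => (hdD (σ i) (τ i)).sub (hdD (τ i) (σ i))
    have hprod : ∀ i, HasDerivWithinAt (fun s => u s y i * torusVorticityTensor (u s) (σ i) (τ i) y)
        (A y i * torusVorticityTensor (u t) (σ i) (τ i) y +
          u t y i * (Torus.partialDeriv (σ i) A y (τ i) - Torus.partialDeriv (τ i) A y (σ i)))
        (Icc a b) t := fun i => (hdu i).mul (hdW i)
    have hsum := HasDerivWithinAt.sum (u := Finset.univ) fun i (_ : i ∈ Finset.univ) => hprod i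
    unfold Torus.timeDerivWithin
    have e2 : (fun s => ∑ i, u s y i * torusVorticityTensor (u s) (σ i) (τ i) y) =
        ∑ i, (fun s => u s y i * torusVorticityTensor (u s) (σ i) (τ i) y) := by
      funext s; simp only [Finset.sum_apply]
    rw [e2, hsum.derivWithin (hU t ht)]
  -- Step 3: the value of the derivative, `∫ ∑ (Aᵢωᵢ + uᵢ (curl A)ᵢ) = 2∫∑ Aᵢωᵢ`
  -- continuity / integrability of the pieces
  have cW : ∀ i, Continuous (torusVorticityTensor (u t) (σ i) (τ i)) := fun i => (hW _ _).continuous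
  have i1 : Integrable (fun y => ∑ i, A y i * torusVorticityTensor (u t) (σ i) (τ i) y) :=
    (continuous_finsetSum _ fun i _ => (hAc i).continuous.mul (cW i)).integrable_unitAddTorus
  have cdA : ∀ j k, Continuous (fun y => Torus.partialDeriv j A y k) :=
    fun j k => ((hAs.partialDeriv j).apply k).continuous
  have i2 : Integrable (fun y => ∑ i, u t y i *
      (Torus.partialDeriv (σ i) A y (τ i) - Torus.partialDeriv (τ i) A y (σ i))) :=
    (continuous_finsetSum _ fun i _ => (huc i).continuous.mul
      ((cdA (σ i) (τ i)).sub (cdA (τ i) (σ i)))).integrable_unitAddTorus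
  -- `∫ ∑ uᵢ (curl A)ᵢ = ∫ ∑ ωᵢ Aᵢ`
  have hcurl : ∫ y, ∑ i, u t y i * (Torus.partialDeriv (σ i) A y (τ i) - Torus.partialDeriv (τ i) A y (σ i)) =
      ∫ y, ∑ i, A y i * torusVorticityTensor (u t) (σ i) (τ i) y := by
    have hL := Torus.integral_sum_mul_curl_eq e (A := fun i y => u t y i) (B := fun i y => A y i) huc hAc
    have eL : ∀ y i, Torus.partialDeriv (σ i) (fun y => A y (τ i)) y - Torus.partialDeriv (τ i) (fun y => A y (σ i)) y =
        Torus.partialDeriv (σ i) A y (τ i) - Torus.partialDeriv (τ i) A y (σ i) := fun y i => by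
      rw [Torus.partialDeriv_apply_coord (hAs.isContDiff (by simp)),
        Torus.partialDeriv_apply_coord (hAs.isContDiff (by simp))]
    have eR : ∀ y i, Torus.partialDeriv (σ i) (fun y => u t y (τ i)) y - Torus.partialDeriv (τ i) (fun y => u t y (σ i)) y =
        torusVorticityTensor (u t) (σ i) (τ i) y := fun y i => by
      rw [Torus.partialDeriv_apply_coord hu1, Torus.partialDeriv_apply_coord hu1, torusVorticityTensor]
    simp only [hσ, hτ] at eL eR ⊢
    simp only [eL, eR] at hL
    rw [hL]
    exact integral_congr_ae (ae_of_all _ fun y => Finset.sum_congr rfl fun i _ => by ring)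
  -- Step 4: `A = νΔu − ∇p + f − (u·∇)u` and the vanishing of the pressure and transport terms
  have hAeq : ∀ y i, A y i = ν * Torus.laplacian (u t) y i - Torus.gradient (p t) y i + f t y i -
      Torus.convect (u t) (u t) y i := by
    intro y i
    have hm := h.momentum t ht y
    have e1 : A y = ν • Torus.laplacian (u t) y - Torus.gradient (p t) y + f t y - Torus.convect (u t) (u t) y := by
      rw [hA, ← hm]; abel
    rw [e1]
    simp only [PiLp.sub_apply, PiLp.add_apply, PiLp.smul_apply, smul_eq_mul]
  -- smoothness of `f t`
  have hft : Torus.IsSmooth (f t) := by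
    have e1 : f t = fun y => Torus.timeDerivWithin (Icc a b) u t y + Torus.convect (u t) (u t) y -
        ν • Torus.laplacian (u t) y + Torus.gradient (p t) y := by
      funext y
      rw [h.momentum t ht y]; abel
    rw [e1]
    have hAs' : Torus.IsSmooth (Torus.timeDerivWithin (Icc a b) u t) := hus.isSmooth_timeDerivWithin hU ht
    exact ((hAs'.add (hut.convect hut)).sub (hut.laplacian.smul ν)).add hpt.gradient
  have hfc : ∀ i, Continuous (fun y => f t y i) := fun i => (hft.apply i).continuous
  -- the pressure term vanishes
  have hpress : ∫ y, ∑ i, Torus.gradient (p t) y i * torusVorticityTensor (u t) (σ i) (τ i) y = 0 := by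
    have h0 := Torus.integral_sum_partialDeriv_mul_curl_eq_zero e hpt (B := fun i y => u t y i) huc
    have eR : ∀ y i, Torus.partialDeriv (σ i) (fun y => u t y (τ i)) y - Torus.partialDeriv (τ i) (fun y => u t y (σ i)) y =
        torusVorticityTensor (u t) (σ i) (τ i) y := fun y i => by
      rw [Torus.partialDeriv_apply_coord hu1, Torus.partialDeriv_apply_coord hu1, torusVorticityTensor]
    have eg : ∀ y i, Torus.gradient (p t) y i = Torus.partialDeriv i (p t) y := fun y i => by
      rw [Torus.gradient_eq_sum_partialDeriv (hpt.isContDiff (by simp))]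
      simp [Finset.sum_apply, Pi.single_apply]
    simp only [hσ, hτ] at eR ⊢
    simp only [eR] at h0
    simp only [eg]
    exact h0
  -- the transport term vanishes
  have hconv : ∫ y, ∑ i, Torus.convect (u t) (u t) y i * torusVorticityTensor (u t) (σ i) (τ i) y = 0 := by
    -- `((u·∇)u)ᵢ = ∑ⱼ uⱼ Wⱼᵢ + ∂ᵢ(½∑ⱼuⱼ²)`
    set φ₂ : UnitAddTorus d → ℝ := fun y => 2⁻¹ * ∑ j, u t y j * u t y j with hφ₂
    have hjS : ∀ j, Torus.IsSmooth (fun y => u t y j * u t y j) := fun j => (huc j).mul (huc j)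
    have hsumS : Torus.IsSmooth (fun y => ∑ j, u t y j * u t y j) := by
      have hl : Torus.lift (fun y => ∑ j, u t y j * u t y j) =
          fun z => ∑ j, Torus.lift (fun y => u t y j * u t y j) z := by
        funext z; simp only [Torus.lift_apply]
      have hj := hjS
      unfold Torus.IsSmooth at hj ⊢
      rw [hl]; exact ContDiff.sum fun j _ => hj j
    have hφ₂s : Torus.IsSmooth φ₂ := (Torus.isSmooth_const _).mul hsumS
    have hdφ₂ : ∀ i y, Torus.partialDeriv i φ₂ y = ∑ j, u t y j * Torus.partialDeriv i (u t) y j := by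
      intro i y
      have hj1 : ∀ j, Torus.IsContDiff 1 (fun y => u t y j * u t y j) :=
        fun j => (hjS j).isContDiff (by simp)
      have e1 : φ₂ = fun y => (2⁻¹ : ℝ) * (fun y => ∑ j, u t y j * u t y j) y := by funext y; rfl
      rw [e1]
      have := Torus.partialDeriv_const_smul (hsumS.isContDiff (by simp)) (2⁻¹ : ℝ) i
      have e2 : (fun y => (2⁻¹ : ℝ) * (fun y => ∑ j, u t y j * u t y j) y) =
          (2⁻¹ : ℝ) • fun y => ∑ j, u t y j * u t y j := by funext y; simp [smul_eq_mul]
      rw [e2, this, Pi.smul_apply, smul_eq_mul,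
        Torus.partialDeriv_finset_sum Finset.univ (fun j _ => hj1 j) i y, Finset.mul_sum]
      refine Finset.sum_congr rfl fun j _ => ?_
      rw [Torus.partialDeriv_mul ((huc j).isContDiff (by simp)) ((huc j).isContDiff (by simp)) i y,
        Torus.partialDeriv_apply_coord hu1]
      ring
    have hsplit : ∀ y i, Torus.convect (u t) (u t) y i =
        (∑ j, u t y j * torusVorticityTensor (u t) j i y) + Torus.partialDeriv i φ₂ y := by
      intro y i
      rw [Torus.convect, Torus.fderiv_apply_eq_sum_partialDeriv hu1 y (u t y), hdφ₂,
        ← Finset.sum_add_distrib]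
      simp only [WithLp.ofLp_sum, Finset.sum_apply, WithLp.ofLp_smul, Pi.smul_apply, smul_eq_mul,
        torusVorticityTensor]
      exact Finset.sum_congr rfl fun j _ => by ring
    have e1 : ∀ y, ∑ i, Torus.convect (u t) (u t) y i * torusVorticityTensor (u t) (σ i) (τ i) y =
        (∑ i, ∑ j, u t y j * torusVorticityTensor (u t) j i y * torusVorticityTensor (u t) (σ i) (τ i) y) +
          ∑ i, Torus.partialDeriv i φ₂ y * torusVorticityTensor (u t) (σ i) (τ i) y := by
      intro y
      rw [← Finset.sum_add_distrib]
      refine Finset.sum_congr rfl fun i _ => ?_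
      rw [hsplit y i, add_mul, Finset.sum_mul]
    have e0 : ∀ y, ∑ i, ∑ j, u t y j * torusVorticityTensor (u t) j i y *
        torusVorticityTensor (u t) (σ i) (τ i) y = 0 := fun y =>
      Torus.sum_sum_mul_torusVorticityTensor_mul_curl_eq_zero e (u t) y
    simp_rw [e1, e0, zero_add]
    have h0 := Torus.integral_sum_partialDeriv_mul_curl_eq_zero e hφ₂s (B := fun i y => u t y i) huc
    have eR : ∀ y i, Torus.partialDeriv (σ i) (fun y => u t y (τ i)) y - Torus.partialDeriv (τ i) (fun y => u t y (σ i)) y =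
        torusVorticityTensor (u t) (σ i) (τ i) y := fun y i => by
      rw [Torus.partialDeriv_apply_coord hu1, Torus.partialDeriv_apply_coord hu1, torusVorticityTensor]
    simp only [hσ, hτ] at eR ⊢
    simp only [eR] at h0
    exact h0
  -- Step 5: assemble
  have hAval : ∫ y, ∑ i, A y i * torusVorticityTensor (u t) (σ i) (τ i) y =
      ν * (∫ y, ∑ i, Torus.laplacian (u t) y i * torusVorticityTensor (u t) (σ i) (τ i) y) +
        ∫ y, ∑ i, f t y i * torusVorticityTensor (u t) (σ i) (τ i) y := by
    have cL : Continuous (fun y => ∑ i, Torus.laplacian (u t) y i * torusVorticityTensor (u t) (σ i) (τ i) y) :=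
      continuous_finsetSum _ fun i _ => (hut.laplacian.apply i).continuous.mul (cW i)
    have cG : Continuous (fun y => ∑ i, Torus.gradient (p t) y i * torusVorticityTensor (u t) (σ i) (τ i) y) :=
      continuous_finsetSum _ fun i _ => (hpt.gradient.apply i).continuous.mul (cW i)
    have cF : Continuous (fun y => ∑ i, f t y i * torusVorticityTensor (u t) (σ i) (τ i) y) :=
      continuous_finsetSum _ fun i _ => (hfc i).mul (cW i)
    have cC : Continuous (fun y => ∑ i, Torus.convect (u t) (u t) y i * torusVorticityTensor (u t) (σ i) (τ i) y) :=
      continuous_finsetSum _ fun i _ => ((hut.convect hut).apply i).continuous.mul (cW i)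
    have e1 : ∀ y, ∑ i, A y i * torusVorticityTensor (u t) (σ i) (τ i) y =
        ν * (∑ i, Torus.laplacian (u t) y i * torusVorticityTensor (u t) (σ i) (τ i) y) -
          (∑ i, Torus.gradient (p t) y i * torusVorticityTensor (u t) (σ i) (τ i) y) +
          (∑ i, f t y i * torusVorticityTensor (u t) (σ i) (τ i) y) -
          ∑ i, Torus.convect (u t) (u t) y i * torusVorticityTensor (u t) (σ i) (τ i) y := by
      intro y
      simp only [hAeq, Finset.mul_sum, ← Finset.sum_sub_distrib, ← Finset.sum_add_distrib]
      exact Finset.sum_congr rfl fun i _ => by ring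
    simp_rw [e1]
    have iL : Integrable (fun y => ν * ∑ i, Torus.laplacian (u t) y i * torusVorticityTensor (u t) (σ i) (τ i) y) :=
      (continuous_const.mul cL).integrable_unitAddTorus
    have iG : Integrable (fun y => ∑ i, Torus.gradient (p t) y i * torusVorticityTensor (u t) (σ i) (τ i) y) :=
      cG.integrable_unitAddTorus
    have iF : Integrable (fun y => ∑ i, f t y i * torusVorticityTensor (u t) (σ i) (τ i) y) :=
      cF.integrable_unitAddTorus
    have iC : Integrable (fun y => ∑ i, Torus.convect (u t) (u t) y i * torusVorticityTensor (u t) (σ i) (τ i) y) :=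
      cC.integrable_unitAddTorus
    have iLG : Integrable (fun y => ν * (∑ i, Torus.laplacian (u t) y i * torusVorticityTensor (u t) (σ i) (τ i) y) -
        ∑ i, Torus.gradient (p t) y i * torusVorticityTensor (u t) (σ i) (τ i) y) := iL.sub iG
    have iLGF : Integrable (fun y => ν * (∑ i, Torus.laplacian (u t) y i * torusVorticityTensor (u t) (σ i) (τ i) y) -
        (∑ i, Torus.gradient (p t) y i * torusVorticityTensor (u t) (σ i) (τ i) y) +
        ∑ i, f t y i * torusVorticityTensor (u t) (σ i) (τ i) y) := iLG.add iF
    rw [integral_sub iLGF iC, integral_add iLG iF, integral_sub iL iG, MeasureTheory.integral_const_mul,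
      hpress, hconv]
    ring
  -- conclusion
  have hval : (∫ y, Torus.timeDerivWithin (Icc a b)
      (fun s y => ∑ i, u s y i * torusVorticityTensor (u s) (σ i) (τ i) y) t y) =
      2 * ν * (∫ x, ∑ i, Torus.laplacian (u t) x i * torusVorticityTensor (u t) (σ i) (τ i) x) +
        2 * (∫ x, ∑ i, f t x i * torusVorticityTensor (u t) (σ i) (τ i) x) := by
    simp_rw [hslice]
    rw [show (fun y => ∑ i, (A y i * torusVorticityTensor (u t) (σ i) (τ i) y +
        u t y i * (Torus.partialDeriv (σ i) A y (τ i) - Torus.partialDeriv (τ i) A y (σ i)))) =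
        fun y => (∑ i, A y i * torusVorticityTensor (u t) (σ i) (τ i) y) +
          ∑ i, u t y i * (Torus.partialDeriv (σ i) A y (τ i) - Torus.partialDeriv (τ i) A y (σ i)) from
        funext fun y => Finset.sum_add_distrib, integral_add i1 i2, hcurl, hAval]
    ring
  rw [hval] at hD
  exact hD

/-- **The helicity balance with the dissipation `−2ν∫ω·curl ω`** (the "viscous destruction of
helicity", Moffatt–Tsinober 1992): same statement as
`Torus.IsClassicalNSSolutionOn.hasDerivWithinAt_helicity`, with `2ν∫∑ᵢ(Δu)ᵢωᵢ` rewritten as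
`−2ν∫∑ᵢ ωᵢ (curlₑ ω)ᵢ` by `curlₑ ω = −Δu` (`Torus.curl_curl_eq_neg_laplacian_of_isDivFree`).
[cite: MoffattTsinober1992, review (viscous helicity balance)] [cite: MajdaBertozziCUP2002, Prop. 1.12 (iv), eq. (1.67)] -/
theorem _root_.Literature.Analysis.FunctionSpaces.Torus.IsClassicalNSSolutionOn.hasDerivWithinAt_helicity'
    (e : d ≃ Fin 3) {a b ν : ℝ} (hab : a < b)
    {u f : ℝ → UnitAddTorus d → EuclideanSpace ℝ d} {p : ℝ → UnitAddTorus d → ℝ}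
    (h : Torus.IsClassicalNSSolutionOn (Icc a b) ν f u p) {t : ℝ} (ht : t ∈ Icc a b) :
    HasDerivWithinAt
      (fun s => ∫ x, ∑ i, u s x i * torusVorticityTensor (u s) (e.symm (e i + 1)) (e.symm (e i + 2)) x)
      (-(2 * ν * (∫ x, ∑ i, torusVorticityTensor (u t) (e.symm (e i + 1)) (e.symm (e i + 2)) x *
          (Torus.partialDeriv (e.symm (e i + 1)) (torusVorticityTensor (u t)
              (e.symm (e (e.symm (e i + 2)) + 1)) (e.symm (e (e.symm (e i + 2)) + 2))) x -
            Torus.partialDeriv (e.symm (e i + 2)) (torusVorticityTensor (u t)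
              (e.symm (e (e.symm (e i + 1)) + 1)) (e.symm (e (e.symm (e i + 1)) + 2))) x))) +
        2 * (∫ x, ∑ i, f t x i * torusVorticityTensor (u t) (e.symm (e i + 1)) (e.symm (e i + 2)) x))
      (Icc a b) t := by
  have hD := h.hasDerivWithinAt_helicity e hab ht
  have hut : Torus.IsSmooth (u t) := h.smooth_velocity.isSmooth_slice ht
  have hcc : ∀ i x, Torus.partialDeriv (e.symm (e i + 1)) (torusVorticityTensor (u t)
        (e.symm (e (e.symm (e i + 2)) + 1)) (e.symm (e (e.symm (e i + 2)) + 2))) x -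
      Torus.partialDeriv (e.symm (e i + 2)) (torusVorticityTensor (u t)
        (e.symm (e (e.symm (e i + 1)) + 1)) (e.symm (e (e.symm (e i + 1)) + 2))) x =
      -Torus.laplacian (u t) x i :=
    fun i x => Torus.curl_curl_eq_neg_laplacian_of_isDivFree e hut (h.divFree t ht) i x
  have e1 : (∫ x, ∑ i, torusVorticityTensor (u t) (e.symm (e i + 1)) (e.symm (e i + 2)) x *
          (Torus.partialDeriv (e.symm (e i + 1)) (torusVorticityTensor (u t)
              (e.symm (e (e.symm (e i + 2)) + 1)) (e.symm (e (e.symm (e i + 2)) + 2))) x -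
            Torus.partialDeriv (e.symm (e i + 2)) (torusVorticityTensor (u t)
              (e.symm (e (e.symm (e i + 1)) + 1)) (e.symm (e (e.symm (e i + 1)) + 2))) x)) =
      -∫ x, ∑ i, Torus.laplacian (u t) x i *
          torusVorticityTensor (u t) (e.symm (e i + 1)) (e.symm (e i + 2)) x := by
    rw [← integral_neg]
    refine integral_congr_ae (ae_of_all _ fun x => ?_)
    dsimp only
    rw [← Finset.sum_neg_distrib]
    exact Finset.sum_congr rfl fun i _ => by rw [hcc]; ring
  rw [e1]
  convert hD using 1
  ring

/-- **Helicity is conserved along classical Euler flows on `T³`** (Moffatt 1969; Majda–Bertozzi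
2002, Prop. 1.12 (iv), eq. (1.67); Doering–Gibbon 1995, (E7.4)): for `ν = 0` and `f = 0`,
`Hₑ(t) = Hₑ(a)` for all `t ∈ [a, b]`. [cite: MajdaBertozziCUP2002, Prop. 1.12 (iv), eq. (1.67)]
[cite: Moffatt1969] -/
theorem _root_.Literature.Analysis.FunctionSpaces.Torus.IsClassicalNSSolutionOn.helicity_eq_of_euler
    (e : d ≃ Fin 3) {a b : ℝ} (hab : a < b)
    {u : ℝ → UnitAddTorus d → EuclideanSpace ℝ d} {p : ℝ → UnitAddTorus d → ℝ}
    (h : Torus.IsClassicalNSSolutionOn (Icc a b) 0 0 u p) {t : ℝ} (ht : t ∈ Icc a b) :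
    (∫ x, ∑ i, u t x i * torusVorticityTensor (u t) (e.symm (e i + 1)) (e.symm (e i + 2)) x) =
      ∫ x, ∑ i, u a x i * torusVorticityTensor (u a) (e.symm (e i + 1)) (e.symm (e i + 2)) x := by
  have hD : ∀ s ∈ Icc a b, HasDerivWithinAt
      (fun s => ∫ x, ∑ i, u s x i * torusVorticityTensor (u s) (e.symm (e i + 1)) (e.symm (e i + 2)) x)
      0 (Icc a b) s := by
    intro s hs
    have := h.hasDerivWithinAt_helicity e hab hs
    simpa using this
  have hcont : ContinuousOn
      (fun s => ∫ x, ∑ i, u s x i * torusVorticityTensor (u s) (e.symm (e i + 1)) (e.symm (e i + 2)) x)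
      (Icc a b) := fun s hs => (hD s hs).continuousWithinAt
  exact constant_of_has_deriv_right_zero hcont
    (fun s hs => (hD s ⟨hs.1, hs.2.le⟩).mono_of_mem_nhdsWithin (Icc_mem_nhdsGE_of_mem hs)) t ht

end Literature.Analysis.FluidPDE

end
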